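import Summits.CriticalPhenomena.PercolationContinuityZ3.Theorems.Transplant.FKConnectivityAllQPat3ShapeOneK
import HarnessLib

/-!
# Connectivity correlation inequalities for `φ_{w,q}`, every `q > 0` — THE PRODUCT CONE FOR ONE-PIECE SHAPES WITH CONTRACTED
# SKELETON EDGES (census g40's `t = 1` certificate check on the minors that contract plain slots)

Proof file with definitions (`--supports stmt-CriticalPhenomena-4575`), census lineage (gen 41) of LANE 2's FK sub-programme;
builds on p205010 (kernel theorem, internal audit signed; external expert review pending).  No named facts, no sorries.
Continues `…Pat3ShapeOneK.lean` (why contracted skeleton states are needed: its module docstring).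
* `FK.coefTab1K` (the coefficient table of a skeleton `(L free, K contracted)` + one marked piece), `FK.sum_shape1TermK`,
  `FK.skelCorrK_le`, `FK.coefTab1K_eq_zero` (structural level bound `2|L| + 2|K| + 3`).
* `FK.nonneg_of_coef_cert` — census g40's product-cone argument (`shape1C_nonneg_of_cert`) with the coefficient table ABSTRACTED:
  a value that is the piece-configuration sum of a table passing `FK.certCheck1` against generators levelwise `≥ 0` on the piece
  minor is `≥ 0` (serves every one-piece engine: `coefTab1`, `coefTab1K`, …).
* **`FK.shape1KC_nonneg_of_cert`**: `certCheck1 (coefTab1K L K …) gens cert Dn dmax` + generators levelwise `≥ 0` on the piece minor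
  `(EQ, CQ; u, v, m)` ⇒ `F ≥ 0` levelwise on `(plainSet p L ∪ EQ, plainSet p K ∪ CQ)` — the bridge 𝒯₂-rows B1/B2 of census g39 in
  every `{free, contracted}` state of the four plain slots (data: `…Pat3BridgeKData*.lean`, census g41).
[cite: AyyerLinussonRavichandran2025, §7 (p. 22)] [cite: Grimmett2006, §1.4 eq. (1.20) (p. 15)]
-/

namespace Summit.CriticalPhenomena.PercolationContinuityZ3.Theorems

namespace FK

open SimpleGraph Literature.Probability.LatticeModels Literature.Probability.Percolation
open scoped Classical

variable {V : Type*}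

section ShapeOneKCone

variable [Fintype V] {ι : Type*} [DecidableEq ι]


/-- **The coefficient table of a one-piece shape with contracted skeleton edges** at residual level `d` and piece patterns
`(P, Q)`: the colouring sum of `F` read at the composite patterns whose corrections (plus the table's own level) equal `d`.
Computable; `decide +kernel` evaluates it. [folklore] -/
def coefTab1K (L K : List (ι × ι)) (i j k ix iy is : ι) (F : ℕ → Pat3 → Pat3 → ℤ) (d : ℕ) (P Q : Pat3) : ℤ :=
  sumBits L.length fun bs =>
    (if skelCorrK L K i j bs P Q = d then F 0 (skelPatK L K i j k ix iy is bs P) (skelPatK L K i j k ix iy is (bs.map (! ·)) Q) else 0) +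
      (if skelCorrK L K i j bs P Q + 1 = d then
        F 1 (skelPatK L K i j k ix iy is bs P) (skelPatK L K i j k ix iy is (bs.map (! ·)) Q) else 0)

omit [Fintype V] in
/-- The colouring sum of `FK.shape1TermK` is the coefficient table at the residual level `μ + |L| + 2|K| - ℓ`. [folklore] -/
theorem sum_shape1TermK (L K : List (ι × ι)) (i j k ix iy is : ι) (F : ℕ → Pat3 → Pat3 → ℤ) (μ ℓ : ℕ) (P Q : Pat3) :
    sumBits L.length (fun bs => shape1TermK L K i j k ix iy is F μ bs ℓ P Q) =
      if ℓ ≤ μ + (L.length + 2 * K.length) then coefTab1K L K i j k ix iy is F (μ + (L.length + 2 * K.length) - ℓ) P Q else 0 := by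
  unfold coefTab1K shape1TermK
  split_ifs with h
  · congr 1
    funext bs
    rw [ite_eq_ite_of_iff (show ℓ + skelCorrK L K i j bs P Q = μ + L.length + 2 * K.length ↔
        skelCorrK L K i j bs P Q = μ + (L.length + 2 * K.length) - ℓ by omega) rfl,
      ite_eq_ite_of_iff (show ℓ + skelCorrK L K i j bs P Q + 1 = μ + L.length + 2 * K.length ↔
        skelCorrK L K i j bs P Q + 1 = μ + (L.length + 2 * K.length) - ℓ by omega) rfl]
  · refine sumBits_eq_zero' L.length fun bs => ?_
    have e1 : ¬ (ℓ + skelCorrK L K i j bs P Q = μ + L.length + 2 * K.length) := by omega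
    have e2 : ¬ (ℓ + skelCorrK L K i j bs P Q + 1 = μ + L.length + 2 * K.length) := by omega
    rw [if_neg e1, if_neg e2, add_zero]

omit [Fintype V] [DecidableEq ι] in
/-- `trueBits` is as long as the edge list. [folklore] -/
theorem length_trueBits (K : List (ι × ι)) : (trueBits K).length = K.length := by
  unfold trueBits; rw [List.length_map]

omit [Fintype V] in
/-- The corrections of a one-piece shape with contracted skeleton edges number at most `2|L| + 2|K| + 2`. [folklore] -/
theorem skelCorrK_le (L K : List (ι × ι)) (i j : ι) (bs : List Bool) (P Q : Pat3) :
    skelCorrK L K i j bs P Q ≤ 2 * L.length + 2 * K.length + 2 := by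
  unfold skelCorrK
  have h1 := (foldBits_snd_le (idMat ι) (zipBits L bs)).trans (length_zipBits_le L bs)
  have h2 := (foldBits_snd_le (idMat ι) (zipBits L (bs.map (! ·)))).trans (length_zipBits_le L _)
  have h3 := (foldBits_snd_le (foldBits (idMat ι) (zipBits L bs)).1 (trueBits K)).trans (length_trueBits K).le
  have h4 := (foldBits_snd_le (foldBits (idMat ι) (zipBits L (bs.map (! ·)))).1 (trueBits K)).trans (length_trueBits K).le
  split_ifs <;> omega

omit [Fintype V] in
/-- The coefficient table vanishes above the structural level bound `2|L| + 2|K| + 3`. [folklore] -/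
theorem coefTab1K_eq_zero (L K : List (ι × ι)) (i j k ix iy is : ι) (F : ℕ → Pat3 → Pat3 → ℤ) {d : ℕ}
    (hd : 2 * L.length + 2 * K.length + 3 < d) (P Q : Pat3) : coefTab1K L K i j k ix iy is F d P Q = 0 := by
  unfold coefTab1K
  refine sumBits_eq_zero' L.length fun bs => ?_
  have h := skelCorrK_le L K i j bs P Q
  have e1 : ¬ (skelCorrK L K i j bs P Q = d) := by omega
  have e2 : ¬ (skelCorrK L K i j bs P Q + 1 = d) := by omega
  rw [if_neg e1, if_neg e2, add_zero]

omit [Fintype V] [DecidableEq ι] in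
/-- **THE PRODUCT CONE, ABSTRACT FORM** (census g40's `shape1C_nonneg_of_cert` with the coefficient table as a parameter): if a value
`X` is the piece-configuration sum of a table `coef` read at residual levels `μ + T - ℓ`, `coef` vanishes above `dmax`, the certificate
check passes against generators levelwise nonnegative on the piece minor `(EQ, CQ; u, v, m)`, then `0 ≤ X`.  Proof:
`2·Dn·X = Σ_γ Dn·(coef + coefᵀ) ≥ Σ_γ certRow = Σ_c λ_c · 2·lev2C (EQ, CQ) (generator c) ≥ 0` (flip `γ ↦ EQ \ γ`, `FK.apExpC_compl`).
[cite: AyyerLinussonRavichandran2025, §7 (p. 22)] -/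
theorem nonneg_of_coef_cert {EQ CQ : Finset (Sym2 V)} {u v m : V} {X : ℤ} {coef : ℕ → Pat3 → Pat3 → ℤ} {μ T : ℕ}
    (hval : X = ∑ γ ∈ EQ.powerset, (if apExpC EQ CQ γ ≤ μ + T then
      coef (μ + T - apExpC EQ CQ γ) (pat3 (γ ∪ CQ) u v m) (pat3 (EQ \ γ ∪ CQ) u v m) else 0))
    {gens : List (ℕ → Pat3 → Pat3 → ℤ)} {cert : List (ℕ × ℕ × ℕ)} {Dn dmax : ℕ} (hDn : 0 < Dn)
    (hzero : ∀ d, dmax < d → ∀ P Q : Pat3, coef d P Q = 0) (hc : certCheck1 coef gens cert Dn dmax = true)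
    (hg : ∀ n, n < gens.length → ∀ ν : ℕ, 0 ≤ lev2C EQ CQ u v m (famGet gens n) ν) : 0 ≤ X := by
  obtain ⟨hshift, hrows⟩ := certCheck1_spec hc
  -- every row of the (symmetrised) cone inequality, at every residual level
  have hrow : ∀ d (P Q : Pat3), certRow gens cert d P Q ≤ (Dn : ℤ) * (coef d P Q + coef d Q P) := by
    intro d P Q
    by_cases hd : d ≤ dmax
    · exact hrows d hd P Q
    · rw [certRow_eq_zero hshift (by omega) P Q, hzero d (by omega), hzero d (by omega), add_zero, mul_zero]
  -- the value flipped
  have hval' : X = ∑ γ ∈ EQ.powerset, (if apExpC EQ CQ γ ≤ μ + T then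
      coef (μ + T - apExpC EQ CQ γ) (pat3 (EQ \ γ ∪ CQ) u v m) (pat3 (γ ∪ CQ) u v m) else 0) := by
    rw [hval, sum_powerset_flip EQ]
    refine Finset.sum_congr rfl fun γ hγ => ?_
    have g := Finset.mem_powerset.1 hγ
    rw [Finset.sdiff_sdiff_eq_self g, apExpC_compl g]
  -- the generators' side
  have hgen : 0 ≤ ∑ γ ∈ EQ.powerset, (if apExpC EQ CQ γ ≤ μ + T then
      certRow gens cert (μ + T - apExpC EQ CQ γ) (pat3 (γ ∪ CQ) u v m) (pat3 (EQ \ γ ∪ CQ) u v m) else 0) := by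
    rw [sum_certRow_eq]
    refine List.sum_nonneg ?_
    intro z hz
    rw [List.mem_map] at hz
    obtain ⟨c, hc', rfl⟩ := hz
    refine mul_nonneg (by exact_mod_cast Nat.zero_le c.1) ?_
    have hn := (hshift c hc').2
    have hA : 0 ≤ ∑ γ ∈ EQ.powerset, (if apExpC EQ CQ γ ≤ μ + T then
        gentry (famGet gens c.2.2) c.2.1 (μ + T - apExpC EQ CQ γ) (pat3 (γ ∪ CQ) u v m) (pat3 (EQ \ γ ∪ CQ) u v m)
        else 0) := by
      rw [sum_gentryC]
      split_ifs
      · exact hg _ hn _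
      · exact le_rfl
    have hB : ∑ γ ∈ EQ.powerset, (if apExpC EQ CQ γ ≤ μ + T then
        gentry (famGet gens c.2.2) c.2.1 (μ + T - apExpC EQ CQ γ) (pat3 (EQ \ γ ∪ CQ) u v m) (pat3 (γ ∪ CQ) u v m)
        else 0) =
        ∑ γ ∈ EQ.powerset, (if apExpC EQ CQ γ ≤ μ + T then
        gentry (famGet gens c.2.2) c.2.1 (μ + T - apExpC EQ CQ γ) (pat3 (γ ∪ CQ) u v m) (pat3 (EQ \ γ ∪ CQ) u v m)
        else 0) := by
      rw [sum_powerset_flip EQ]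
      refine Finset.sum_congr rfl fun γ hγ => ?_
      have g := Finset.mem_powerset.1 hγ
      rw [Finset.sdiff_sdiff_eq_self g, apExpC_compl g]
    have split : ∑ γ ∈ EQ.powerset, (if apExpC EQ CQ γ ≤ μ + T then
        gentry (famGet gens c.2.2) c.2.1 (μ + T - apExpC EQ CQ γ) (pat3 (γ ∪ CQ) u v m) (pat3 (EQ \ γ ∪ CQ) u v m) +
          gentry (famGet gens c.2.2) c.2.1 (μ + T - apExpC EQ CQ γ) (pat3 (EQ \ γ ∪ CQ) u v m) (pat3 (γ ∪ CQ) u v m)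
        else 0) =
        (∑ γ ∈ EQ.powerset, (if apExpC EQ CQ γ ≤ μ + T then
          gentry (famGet gens c.2.2) c.2.1 (μ + T - apExpC EQ CQ γ) (pat3 (γ ∪ CQ) u v m) (pat3 (EQ \ γ ∪ CQ) u v m)
          else 0)) +
        ∑ γ ∈ EQ.powerset, (if apExpC EQ CQ γ ≤ μ + T then
          gentry (famGet gens c.2.2) c.2.1 (μ + T - apExpC EQ CQ γ) (pat3 (EQ \ γ ∪ CQ) u v m) (pat3 (γ ∪ CQ) u v m)
          else 0) := by
      rw [← Finset.sum_add_distrib]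
      refine Finset.sum_congr rfl fun γ _ => ?_
      split_ifs <;> simp
    rw [split, hB]
    linarith
  -- assemble: `2 · Dn · X ≥ Σ certRow ≥ 0`
  have hsum : ∑ γ ∈ EQ.powerset, (if apExpC EQ CQ γ ≤ μ + T then
      certRow gens cert (μ + T - apExpC EQ CQ γ) (pat3 (γ ∪ CQ) u v m) (pat3 (EQ \ γ ∪ CQ) u v m) else 0) ≤
      (Dn : ℤ) * (X + X) := by
    rw [show (Dn : ℤ) * (X + X) = (Dn : ℤ) * X + (Dn : ℤ) * X by ring]
    conv_rhs => arg 1; rw [hval]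
    conv_rhs => arg 2; rw [hval']
    rw [Finset.mul_sum, Finset.mul_sum, ← Finset.sum_add_distrib]
    refine Finset.sum_le_sum fun γ _ => ?_
    split_ifs with hl
    · rw [← mul_add]; exact hrow _ _ _
    · simp
  have h2 : 0 ≤ (Dn : ℤ) * (X + X) := hgen.trans hsum
  have hDn' : (0 : ℤ) < Dn := by exact_mod_cast hDn
  nlinarith

variable {p : ι → V} {L K : List (ι × ι)} {EQ : Finset (Sym2 V)} {VQ : Set V} {u v m x y s : V} {i j k ix iy is : ι}

/-- **THE PRODUCT-CONE THEOREM FOR ONE-PIECE SHAPES WITH CONTRACTED SKELETON EDGES, PIECE READ AS A MINOR**: if census g40's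
certificate check passes for `FK.coefTab1K` against a generator family levelwise nonnegative on the piece minor `(EQ, CQ; u, v, m)`,
then `F` is levelwise nonnegative on the composite minor `(plainSet p L ∪ EQ, plainSet p K ∪ CQ)` at `(x, y, s)` — the bridge
𝒯₂-rows B1/B2 (and every other one-piece `K₄`-skeleton leaf) in ALL `{free, contracted}` states of the plain slots.
[cite: AyyerLinussonRavichandran2025, §7 (p. 22)] -/
theorem shape1KC_nonneg_of_cert {CQ : Finset (Sym2 V)} (hinj : Function.Injective p)
    (hQ : ∀ e ∈ (↑(EQ ∪ CQ) : Set (Sym2 V)), ∀ z ∈ e, z ∈ VQ)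
    (huv : u ≠ v) (hmQ : m ∈ VQ) (hmu : m ≠ u) (hmv : m ≠ v) (hp : ∀ a, p a ∈ VQ → p a = u ∨ p a = v ∨ p a = m)
    (hi : p i = u) (hj : p j = v) (hk : p k = m) (hx : p ix = x) (hy : p iy = y) (hs : p is = s)
    (hL : ∀ e ∈ L, p e.1 ≠ p e.2) (hnd : (L.map (pedge p)).Nodup) (hLm : ∀ e ∈ L, p e.1 ≠ m ∧ p e.2 ≠ m)
    (hKm : ∀ e ∈ K, p e.1 ≠ m ∧ p e.2 ≠ m)
    (hdQ : Disjoint (plainSet p L) EQ) (F : ℕ → Pat3 → Pat3 → ℤ)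
    {gens : List (ℕ → Pat3 → Pat3 → ℤ)} {cert : List (ℕ × ℕ × ℕ)} {Dn dmax : ℕ} (hDn : 0 < Dn)
    (hdm : 2 * L.length + 2 * K.length + 3 ≤ dmax) (hc : certCheck1 (coefTab1K L K i j k ix iy is F) gens cert Dn dmax = true)
    (hg : ∀ n, n < gens.length → ∀ ν : ℕ, 0 ≤ lev2C EQ CQ u v m (famGet gens n) ν) (μ : ℕ) :
    0 ≤ lev2C (plainSet p L ∪ EQ) (plainSet p K ∪ CQ) x y s F μ := by
  refine nonneg_of_coef_cert (μ := μ) (T := L.length + 2 * K.length) ?_ hDn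
    (fun d hd P Q => coefTab1K_eq_zero L K i j k ix iy is F (by omega) P Q) hc hg
  rw [lev2C_shape1K hinj hQ huv hmQ hmu hmv hp hi hj hk hx hy hs hL hnd hLm hKm hdQ F μ]
  exact Finset.sum_congr rfl fun γ _ => sum_shape1TermK L K i j k ix iy is F μ _ _ _

end ShapeOneKCone

end FK

end Summit.CriticalPhenomena.PercolationContinuityZ3.Theorems
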